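/-
Copyright (c) 2026 the pub-hodgecm-mathlib formalisation cell (harness21).  Prover seat hodgecm-mathlib-R90-C10-p02 (g3), SLAB R90-TF, section S1 «Ch. 10∕12 local»
(base R90-C10); crux H413 = `stmt-HodgeConjecture-24833`; line (D-1) «B_pos at INERT places» of U4Keys :182 (S1 junction A2′), memo
`R90/R90-C10-p05/g2/DESIGN-Bpos-inert.md` f70d293d60bf8a4b; card (B-5z) «the `HE` discharge modulo the master» dealt BY NAME by R90-C10-plan (g2) 2026-09-05T00:35:59Z,
FILE A of its two-file cut (p02 (g3) 00:41Z).  KERNEL module: THEOREMS ONLY (no definition, no named fact, no `sorry`, no instance, no notation).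
-/
import Summits.HodgeConjecture.HodgeConjecture.Theorems.K2E3BranchBCasselmanPairIntegrands     -- ★ (K2E3-p03 (g9)) the depth-zero model: `tau_apply_one_eq` (the `τ(p)`-reading); brings ★ `K2E3BranchBCellFunctionsCM` (§0 `exists_coe_eA_eq_upper`, §5 cell values generic in the subgroup), ★ `K2E3BranchBCellGeometry`
import Summits.HodgeConjecture.HodgeConjecture.Theorems.R90S1BposCellCoverTwoDepthCM             -- ★ p863167 (B-2b′) (R90-C10-p05 (g2)): `symm_mem_map_conj_of_mem_map_conj`; brings ★ p862537 `K2E3LowerUnipotentDeepCellTwoDepth` (`mem_of_coe_eq_upper`, `exists_borel_mul_weylLongU_mul_mem_of_v_div_le`)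
import Summits.HodgeConjecture.HodgeConjecture.Theorems.R90S1BranchBDeterminantVanishingCells     -- ★ p862976 (B-0) (R90-C10-p05 (g2)): `toFun_eq_zero_of_mem_cells` (a type vector vanishes on the irrelevant cells)
import Summits.HodgeConjecture.HodgeConjecture.Theorems.R90S1BposBruhatCellsTwoDepth              -- ★ p863131 (B-2b) (R90-C10-p05 (g2)): `one_of_coe_eq_upper_of_eq_zero` (`u(y, 0) = 1`)
import HarnessLib

/-!
# R90-TF · S1 «Ch10-local» ∕ K2 E3 «U4Keys» :182, BRANCH B AT POSITIVE DEPTH (inert) — brick (B-5z) FILE A: THE FOUR CELL INTEGRANDS OF THE CASSELMAN PAIR AT ROCHE'S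
# GROUP `J_e`, POINTWISE — for a `(J_e, θ)`-eigen-section `f` of `i(χ₁, 1)` on `U(Φ₃)(L⁺_v)` and `u ∈ N(L⁺_v)`, `eA u = u(x, z)`:
# `f(w₀u) = f(w₀)` on `J_e`, `= χ₁((σz)⁻¹)‖z‖⁻¹·f(1)` on the DEEP cell `|z| ≥ |ϖ|⁻¹, |x∕z| ≤ |ϖ|^{r₂}`, `0` else; `f(w₀uw₀) = f(1)` on `J_e`, `= χ₁((σz)⁻¹)‖z‖⁻¹·f(w₀)` on the SHARP cell
# `|z| ≥ 1, |x∕z| ≤ |ϖ|^{r₁}`, `0` else — the `J_e`-twin of ★ `K2E3BranchBCasselmanPairIntegrands` §2–§3 (memo (M11), (M22), (M12), (M21))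
# [Casselman1980 §3; Casselman1995 Prop. 1.3.1, §6.3–§6.4; Roche1998 §3–§4; Keys1984 §3, §7 Thm (2); Rogawski1990 §1.10, §12.1]

Cell `pub/hodgecm-mathlib`, crux H413 = `stmt-HodgeConjecture-24833`, route of record `HCCMUnconditional` (no route verbs); R90-TF section S1 (junction socket A2′ = U4Keys :217, REL
over :155 and :182).  THEOREMS ONLY; lane `--supports stmt-HodgeConjecture-24833 --as helper`, count-neutral.  NOT THE PAYER of :182: consumed by FILE B `R90S1BposPairEntriesOfMaster`
(the four entries from the master-integral letter) which instantiates the letter `HE` of ★ p863671 `R90S1KeysThmTwoPosDepthBranchBInertAllLeaf` §2.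
FRAME = the (G3) frame of the d0B files `(L v) (w hw) (eA heA) (ϖ hϖ)` + the two-depth letters `(r₁ r₂ Jg hJg Je hJe)` of ★ (B-2b″) (`e = (r₁, 0; r₂, 1)`, no inequality between `r₁, r₂`
is used here) + `w₀` of matrix `Φ₃`; `θ(g) := if IsUnit g₀₀ then χ₁(unit g₀₀) else 0` (the `dite` of every B_pos file), `τ = ((χ₁, 1) ∘ proj) ⊗ δ^{1∕2}` (the carrier of ★ (B-1′)).
THE POINT.  At the Iwahori (depth zero) `G = P·I ⊔ P·w₀·I` and the two cell values of ★ `K2E3BranchBCellFunctionsCM` §5 suffice; at `J_e` there are INTERMEDIATE cells `P·r·J_e`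
(`r ∈ R` = the N̄-shells off `J_e` and off the sharp big cell, the family of ★ (B-2b″) `hR`), on which every `(J_e, θ)`-type vector VANISHES (★ (B-0) `toFun_eq_zero_of_mem_cells`, fed by the
witness letter `hwit` = ★ (B-2b″) `cells_witness_kZero`).  So the four integrands are computed by: the explicit factorisations `w₀u = p·κ` (`z ≠ 0`) and `w₀uw₀ = p·w₀·n₂` of ★
`K2E3BranchBCellGeometry` §2∕§3 pulled back along `eA` (§1 here, WITHOUT the depth-zero side conditions), the `J_e`-tests of `κ = ū(x∕z, 1∕z)` and `n₂ = u(x∕z, 1∕z)` on their matrices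
(★ p862537 `mem_of_coe_eq_upper`, §1 `mem_levelGroup_of_coe_eq_lower`), the `τ(p)`-reading ★ `tau_apply_one_eq` (at `χ₂ = 1`), `θ = 1` on unipotents, and — off `J_e` — the dichotomy
«sharp ⟹ `P·w₀·J_e` (★ p862537) ∣ not sharp ⟹ `r ∈ R` ⟹ `0`».
* §1 frame lemmas: `exists_eq_mul_of_ne_zero` (`w₀u = pκ`, matrices), `exists_conj_eq_mul_of_ne_zero` (`w₀uw₀ = p w₀ n₂`), `mem_levelGroup_of_coe_eq_lower`, `lower_mem_map_conj`
  (`κ ∈ N̄(L⁺_v)`), `conj_mem_map_conj` (`w₀uw₀ ∈ N̄(L⁺_v)`).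
* §2 on `J_e`: **`toFun_weyl_mul_eq_of_mem`** (`f(w₀u) = f(w₀)`), **`toFun_conj_weyl_eq_of_mem`** (`f(w₀uw₀) = f(1)`).
* §3 the two big-cell values: **`toFun_weyl_mul_eq_of_deep`**, **`toFun_conj_weyl_eq_of_sharp`** (value `χ₁((σb)⁻¹)·‖b‖⁻¹·f(1)` ∕ `·f(w₀)`, `b = u₀₂`, frame-v1 bytes of `F₀`).
* the vanishing off those cells (letters `R hR hwit` of ★ (B-2b″)) is FILE A′ `R90S1BposPairIntegrandsVanishingTwoDepth` (400-line rule).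
HONEST LABEL.  HC_CM is proved only modulo the 7 printed citations (2 remaining named inputs: hLiu418 = `stmt-HodgeConjecture-24832`, h413 = `stmt-HodgeConjecture-24833`) until rung 0
closes; count-neutral — pointwise integrand values close NOTHING; :182 ∕ A2′ OPEN; REL ≠ ★ ≠ BUILT.

## References
* [Casselman1980] W. Casselman, *The unramified principal series of p-adic groups I*, Compositio Math. 40 (1980), §3.
* [Casselman1995] W. Casselman, *Introduction to the theory of admissible representations of `p`-adic reductive groups* (1995), Prop. 1.3.1, §6.3–§6.4.
* [Roche1998] A. Roche, *Types and Hecke algebras for principal series representations of split reductive p-adic groups*, Ann. Sci. ÉNS (4) 31 (1998), §3–§4.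
* [Keys1984] D. Keys, *Principal series representations of special unitary groups over local fields*, Compositio Math. 51 (1984), §3, §7 Theorem (2) p. 126.
* [Rogawski1990] J. D. Rogawski, *Automorphic Representations of Unitary Groups in Three Variables*, Ann. of Math. Stud. 123 (1990), §1.10 p. 9, §12.1 p. 171.
* [BruhatTits1972] F. Bruhat, J. Tits, *Groupes réductifs sur un corps local I*, Publ. Math. IHÉS 41 (1972), (4.4.4), (6.4.9).
-/

set_option autoImplicit false
-- the mandated namespace has the single-problem summit's repeated segment (`HodgeConjecture.HodgeConjecture`)
set_option linter.dupNamespace false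

noncomputable section

open NumberField IsDedekindDomain
open scoped Matrix MatrixGroups WithZero Valued NNReal
open Literature.NumberTheory Literature.NumberTheory.Automorphic Literature.NumberTheory.Automorphic.UnitaryGroup
open Literature.NumberTheory.Rogawski1990

namespace Summit.HodgeConjecture.HodgeConjecture.R90.S1.BposPairIntegrandsTwoDepth

open Summit.HodgeConjecture.HodgeConjecture.Cruxes.H413
open Summit.HodgeConjecture.HodgeConjecture.Cruxes.H413.K2E3DepthZeroIwahoriCharacterCM
open Summit.HodgeConjecture.HodgeConjecture.Cruxes.H413.K2E3BranchALettersCM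
open Summit.HodgeConjecture.HodgeConjecture.Cruxes.H413.K2E3BranchBCellFunctionsCM
open Summit.HodgeConjecture.HodgeConjecture.R90.S1

variable (L : Type) [Field L] [NumberField L] [IsCMField L] (v : HeightOneSpectrum (𝓞 ↥(maximalRealSubfield L)))
  (w : PlacesOver L v) (hw : IsCMField.complexConj L • w.1 = w.1)
  (eA : Gqs L v ≃ₜ* ↥(unitaryGroupOfForm (galAdicCompletionMap (L := L) (IsCMField.complexConj L) hw) ((StdForm.antidiagonal 3).over (w.1.adicCompletion L))))
  (heA : ∀ g : Gqs L v,
    ((eA g : ↥(unitaryGroupOfForm (galAdicCompletionMap (L := L) (IsCMField.complexConj L) hw) ((StdForm.antidiagonal 3).over (w.1.adicCompletion L)))) :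
        GL (Fin 3) (w.1.adicCompletion L)) =
      ((localNonsplitEquiv (IsCMField.complexConj L) (qsForm L) (IsCMField.complexConj_ne_one L) w hw g :
        ↥(unitaryGroupOfForm (galAdicCompletionMap (L := L) (IsCMField.complexConj L) hw) (placeForm (qsForm L) w.1))) : GL (Fin 3) (w.1.adicCompletion L)))
  {ϖ : w.1.adicCompletion L} (hϖ : Valued.v ϖ = WithZero.exp (-1 : ℤ))
  (r₁ r₂ : ℕ) (Jg : Subgroup ↥(unitaryGroupOfForm (galAdicCompletionMap (L := L) (IsCMField.complexConj L) hw) ((StdForm.antidiagonal 3).over (w.1.adicCompletion L))))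
  (hJg : ∀ k : ↥(unitaryGroupOfForm (galAdicCompletionMap (L := L) (IsCMField.complexConj L) hw) ((StdForm.antidiagonal 3).over (w.1.adicCompletion L))),
    k ∈ Jg ↔ ∀ i j, Valued.v (((k : GL (Fin 3) (w.1.adicCompletion L)) : Matrix (Fin 3) (Fin 3) (w.1.adicCompletion L)) i j) ≤
      Valued.v ϖ ^ (![![0, r₁, 0], ![r₂, 0, r₁], ![1, r₂, 0]] : Fin 3 → Fin 3 → ℕ) i j)
  (Je : Subgroup (Gqs L v)) (hJe : Je = Jg.comap eA.toMulEquiv.toMonoidHom)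
  (w₀ : Gqs L v) (hw₀ : Units.val (w₀.val : GL (Fin 3) (LocalRing L v)) = cmLocalForm L 3 v)

/-! ## §1 Frame lemmas: the two factorisations without depth conditions, the `J_e`-test of a lower unitriangular matrix, `N̄`-memberships -/

include hw heA hw₀ in
/-- **`w₀ · u = p · κ`, `p ∈ P`, for `u ∈ N(L⁺_v)` with `eA u = u(x, z)`, `z ≠ 0`** — ★ `K2E3BranchBCellGeometry.exists_weylLongU_mul_eq` pulled back along `eA` (`eA⁻¹ B ⊆ P` ★
`symm_mem_P_of_mem_borelU`, `eA w₀ = w` ★ `map_weyl_eq_weylLongU`), with the place matrices of `p` (diagonal `((σz)⁻¹, −σz∕z, z)`) and of `κ = ū(x∕z, 1∕z)`; the depth-zero version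
★ `exists_eq_mul_of_one_lt_v` without its side condition `|z| > 1` (which only served `κ ∈ I`). [cite: Rogawski1990, §1.10 p. 9] [cite: Casselman1995, Prop. 1.3.1] -/
theorem exists_eq_mul_of_ne_zero {u : Gqs L v} {x z : w.1.adicCompletion L}
    (hux : (((eA u : ↥(unitaryGroupOfForm (galAdicCompletionMap (L := L) (IsCMField.complexConj L) hw) ((StdForm.antidiagonal 3).over (w.1.adicCompletion L)))) :
          GL (Fin 3) (w.1.adicCompletion L)) : Matrix (Fin 3) (Fin 3) (w.1.adicCompletion L)) =
        !![1, x, z; 0, 1, -galAdicCompletionMap (L := L) (IsCMField.complexConj L) hw x; 0, 0, 1])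
    (hrel : z + galAdicCompletionMap (L := L) (IsCMField.complexConj L) hw z + x * galAdicCompletionMap (L := L) (IsCMField.complexConj L) hw x = 0) (hz : z ≠ 0) :
    ∃ p : Gqs L v, (p : ↥(unitaryGroupOfForm (conjLocal L (IsCMField.complexConj L) v) (cmLocalForm L 3 v))) ∈ (cmBorelTriple L 3 v).P ∧ ∃ κ : Gqs L v, w₀ * u = p * κ ∧
      (((eA p : ↥(unitaryGroupOfForm (galAdicCompletionMap (L := L) (IsCMField.complexConj L) hw) ((StdForm.antidiagonal 3).over (w.1.adicCompletion L)))) :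
          GL (Fin 3) (w.1.adicCompletion L)) : Matrix (Fin 3) (Fin 3) (w.1.adicCompletion L)) =
        !![(galAdicCompletionMap (L := L) (IsCMField.complexConj L) hw z)⁻¹, -(x * z⁻¹), 1;
           0, -(galAdicCompletionMap (L := L) (IsCMField.complexConj L) hw z * z⁻¹), -galAdicCompletionMap (L := L) (IsCMField.complexConj L) hw x;
           0, 0, z] ∧
      (((eA κ : ↥(unitaryGroupOfForm (galAdicCompletionMap (L := L) (IsCMField.complexConj L) hw) ((StdForm.antidiagonal 3).over (w.1.adicCompletion L)))) :
          GL (Fin 3) (w.1.adicCompletion L)) : Matrix (Fin 3) (Fin 3) (w.1.adicCompletion L)) =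
        !![1, 0, 0;
           -(galAdicCompletionMap (L := L) (IsCMField.complexConj L) hw x * (galAdicCompletionMap (L := L) (IsCMField.complexConj L) hw z)⁻¹), 1, 0;
           z⁻¹, x * z⁻¹, 1] := by
  have hσσ : ∀ y, (galAdicCompletionMap (L := L) (IsCMField.complexConj L) hw) ((galAdicCompletionMap (L := L) (IsCMField.complexConj L) hw) y) = y :=
    galAdicCompletionMap_galAdicCompletionMap_of_smul_eq (IsCMField.complexConj L) w (IsCMField.complexConj_ne_one L) hw
  obtain ⟨p, κ, hfac, hp, hκ⟩ := K2E3BranchBCellGeometry.exists_weylLongU_mul_eq _ rfl hσσ hux hrel hz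
  refine ⟨eA.symm p, symm_mem_P_of_mem_borelU L v w hw eA heA (cmBorelTriple L 3 v) rfl (K2E3BranchBCellGeometry.mem_borelU_of_coe_eq _ hp), eA.symm κ, ?_, ?_, ?_⟩
  · apply eA.injective
    rw [map_mul, map_mul, ContinuousMulEquiv.apply_symm_apply, ContinuousMulEquiv.apply_symm_apply, map_weyl_eq_weylLongU L v w hw eA heA w₀ hw₀, hfac]
  · rw [ContinuousMulEquiv.apply_symm_apply]; exact hp
  · rw [ContinuousMulEquiv.apply_symm_apply]; exact hκ

include hw heA hw₀ in
/-- **`w₀ · u · w₀ = p · w₀ · n₂`, `p ∈ P`, for `u ∈ N(L⁺_v)` with `eA u = u(x, z)`, `z ≠ 0`** — ★ `K2E3BranchBCellGeometry.exists_weylLongU_mul_mul_weylLongU_eq` pulled back along `eA`, with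
the place matrices of `p` and of `n₂ = u(x∕z, 1∕z)`; ★ `exists_conj_eq_mul_of_one_le_v` without `|z| ≥ 1`. [cite: Rogawski1990, §1.10 p. 9] [cite: Casselman1995, Prop. 1.3.1] -/
theorem exists_conj_eq_mul_of_ne_zero {u : Gqs L v} {x z : w.1.adicCompletion L}
    (hux : (((eA u : ↥(unitaryGroupOfForm (galAdicCompletionMap (L := L) (IsCMField.complexConj L) hw) ((StdForm.antidiagonal 3).over (w.1.adicCompletion L)))) :
          GL (Fin 3) (w.1.adicCompletion L)) : Matrix (Fin 3) (Fin 3) (w.1.adicCompletion L)) =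
        !![1, x, z; 0, 1, -galAdicCompletionMap (L := L) (IsCMField.complexConj L) hw x; 0, 0, 1])
    (hrel : z + galAdicCompletionMap (L := L) (IsCMField.complexConj L) hw z + x * galAdicCompletionMap (L := L) (IsCMField.complexConj L) hw x = 0) (hz : z ≠ 0) :
    ∃ p : Gqs L v, (p : ↥(unitaryGroupOfForm (conjLocal L (IsCMField.complexConj L) v) (cmLocalForm L 3 v))) ∈ (cmBorelTriple L 3 v).P ∧ ∃ n₂ : Gqs L v,
      w₀ * u * w₀ = p * w₀ * n₂ ∧
      (((eA p : ↥(unitaryGroupOfForm (galAdicCompletionMap (L := L) (IsCMField.complexConj L) hw) ((StdForm.antidiagonal 3).over (w.1.adicCompletion L)))) :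
          GL (Fin 3) (w.1.adicCompletion L)) : Matrix (Fin 3) (Fin 3) (w.1.adicCompletion L)) =
        !![(galAdicCompletionMap (L := L) (IsCMField.complexConj L) hw z)⁻¹, -(x * z⁻¹), 1;
           0, -(galAdicCompletionMap (L := L) (IsCMField.complexConj L) hw z * z⁻¹), -galAdicCompletionMap (L := L) (IsCMField.complexConj L) hw x;
           0, 0, z] ∧
      (((eA n₂ : ↥(unitaryGroupOfForm (galAdicCompletionMap (L := L) (IsCMField.complexConj L) hw) ((StdForm.antidiagonal 3).over (w.1.adicCompletion L)))) :
          GL (Fin 3) (w.1.adicCompletion L)) : Matrix (Fin 3) (Fin 3) (w.1.adicCompletion L)) =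
        !![1, x * z⁻¹, z⁻¹;
           0, 1, -(galAdicCompletionMap (L := L) (IsCMField.complexConj L) hw x * (galAdicCompletionMap (L := L) (IsCMField.complexConj L) hw z)⁻¹);
           0, 0, 1] := by
  have hσσ : ∀ y, (galAdicCompletionMap (L := L) (IsCMField.complexConj L) hw) ((galAdicCompletionMap (L := L) (IsCMField.complexConj L) hw) y) = y :=
    galAdicCompletionMap_galAdicCompletionMap_of_smul_eq (IsCMField.complexConj L) w (IsCMField.complexConj_ne_one L) hw
  obtain ⟨p, n₂, hfac, hp, hn₂⟩ := K2E3BranchBCellGeometry.exists_weylLongU_mul_mul_weylLongU_eq _ rfl hσσ hux hrel hz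
  refine ⟨eA.symm p, symm_mem_P_of_mem_borelU L v w hw eA heA (cmBorelTriple L 3 v) rfl (K2E3BranchBCellGeometry.mem_borelU_of_coe_eq _ hp), eA.symm n₂, ?_, ?_, ?_⟩
  · apply eA.injective
    rw [map_mul, map_mul, map_mul, map_mul, ContinuousMulEquiv.apply_symm_apply, ContinuousMulEquiv.apply_symm_apply, map_weyl_eq_weylLongU L v w hw eA heA w₀ hw₀,
      hfac]
  · rw [ContinuousMulEquiv.apply_symm_apply]; exact hp
  · rw [ContinuousMulEquiv.apply_symm_apply]; exact hn₂

include hJg hJe in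
/-- **The `J_e`-test of a LOWER unitriangular element**: `eA κ = ū = [[1,0,0],[a,1,0],[c,b,1]]` with `|a| ≤ |ϖ|^{r₂}`, `|b| ≤ |ϖ|^{r₂}`, `|c| ≤ |ϖ|¹` gives `κ ∈ J_e`
(`e = (r₁, 0; r₂, 1)`: the strictly lower entries `(1,0), (2,1) ↦ r₂`, `(2,0) ↦ 1`; twin of ★ p862537 `mem_of_coe_eq_upper`). [cite: BruhatTits1972, (6.4.9)] [cite: Roche1998, §3] -/
theorem mem_levelGroup_of_coe_eq_lower {κ : Gqs L v} {a b c : w.1.adicCompletion L}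
    (hκ : (((eA κ : ↥(unitaryGroupOfForm (galAdicCompletionMap (L := L) (IsCMField.complexConj L) hw) ((StdForm.antidiagonal 3).over (w.1.adicCompletion L)))) :
          GL (Fin 3) (w.1.adicCompletion L)) : Matrix (Fin 3) (Fin 3) (w.1.adicCompletion L)) = !![1, 0, 0; a, 1, 0; c, b, 1])
    (ha : Valued.v a ≤ Valued.v ϖ ^ r₂) (hb : Valued.v b ≤ Valued.v ϖ ^ r₂) (hc : Valued.v c ≤ Valued.v ϖ ^ 1) : κ ∈ Je := by
  subst hJe
  rw [Subgroup.mem_comap]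
  change eA κ ∈ Jg
  rw [hJg, hκ]
  intro i j
  fin_cases i <;> fin_cases j
  all_goals simp only [Fin.zero_eta, Fin.mk_one, Fin.reduceFinMk, Fin.isValue, Matrix.of_apply, Matrix.cons_val', Matrix.cons_val_zero, Matrix.cons_val_one,
    Matrix.cons_val, Matrix.empty_val', Matrix.cons_val_fin_one, map_one, map_zero, zero_le, pow_zero, le_refl]
  all_goals first | exact ha | exact hb | exact hc

/-- **`eA κ ∈ N̄ = N.map (conj w)` in the place model** for `κ` of place matrix `ū(x∕z, 1∕z)`: `w · (eA κ) · w` is upper unitriangular (★ `weylLongU_mul_mul_weylLongU_mem_unipotentU`,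
`w² = 1`; pattern of ★ (B-2b) `exists_borel_mul_lower_of_weylLongU_mul`). [cite: Rogawski1990, §1.10 p. 9] -/
theorem lower_mem_map_conj_model {κ : Gqs L v} {x z : w.1.adicCompletion L}
    (hκ : (((eA κ : ↥(unitaryGroupOfForm (galAdicCompletionMap (L := L) (IsCMField.complexConj L) hw) ((StdForm.antidiagonal 3).over (w.1.adicCompletion L)))) :
          GL (Fin 3) (w.1.adicCompletion L)) : Matrix (Fin 3) (Fin 3) (w.1.adicCompletion L)) =
        !![1, 0, 0;
           -(galAdicCompletionMap (L := L) (IsCMField.complexConj L) hw x * (galAdicCompletionMap (L := L) (IsCMField.complexConj L) hw z)⁻¹), 1, 0;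
           z⁻¹, x * z⁻¹, 1]) :
    eA κ ∈ ((borelTriple (galAdicCompletionMap (L := L) (IsCMField.complexConj L) hw) ((StdForm.antidiagonal 3).over (w.1.adicCompletion L)) rfl).N).map
      (MulAut.conj (weylLongU (galAdicCompletionMap (L := L) (IsCMField.complexConj L) hw) (rfl : (StdForm.antidiagonal 3).over (w.1.adicCompletion L) = _))).toMonoidHom := by
  have hww := weylLongU_mul_weylLongU (galAdicCompletionMap (L := L) (IsCMField.complexConj L) hw) (rfl : (StdForm.antidiagonal 3).over (w.1.adicCompletion L) = _)
  have hwinv := inv_eq_of_mul_eq_one_right hww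
  have hlow : ∀ i j : Fin 3, i < j →
      (((eA κ : ↥(unitaryGroupOfForm (galAdicCompletionMap (L := L) (IsCMField.complexConj L) hw) ((StdForm.antidiagonal 3).over (w.1.adicCompletion L)))) :
        GL (Fin 3) (w.1.adicCompletion L)) : Matrix (Fin 3) (Fin 3) (w.1.adicCompletion L)) i j = 0 := by
    intro i j hij
    rw [hκ]
    fin_cases i <;> fin_cases j <;> first | rfl | exact absurd hij (by decide)
  have hdiag : ∀ i : Fin 3,
      (((eA κ : ↥(unitaryGroupOfForm (galAdicCompletionMap (L := L) (IsCMField.complexConj L) hw) ((StdForm.antidiagonal 3).over (w.1.adicCompletion L)))) :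
        GL (Fin 3) (w.1.adicCompletion L)) : Matrix (Fin 3) (Fin 3) (w.1.adicCompletion L)) i i = 1 := by
    intro i
    rw [hκ]
    fin_cases i <;> rfl
  refine Subgroup.mem_map.2 ⟨_, weylLongU_mul_mul_weylLongU_mem_unipotentU _ rfl hlow hdiag, ?_⟩
  rw [MulEquiv.coe_toMonoidHom, MulAut.conj_apply, hwinv, ← mul_assoc, ← mul_assoc, hww, one_mul, mul_assoc, hww, mul_one]

include hw heA hw₀ in
/-- **`κ ∈ N̄(L⁺_v) = N.map (conj w₀)`** for `κ` of place matrix `ū(x∕z, 1∕z)` (`lower_mem_map_conj_model` pulled back by ★ (B-2b′) `symm_mem_map_conj_of_mem_map_conj`).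
[cite: Rogawski1990, §1.10 p. 9] -/
theorem lower_mem_map_conj {κ : Gqs L v} {x z : w.1.adicCompletion L}
    (hκ : (((eA κ : ↥(unitaryGroupOfForm (galAdicCompletionMap (L := L) (IsCMField.complexConj L) hw) ((StdForm.antidiagonal 3).over (w.1.adicCompletion L)))) :
          GL (Fin 3) (w.1.adicCompletion L)) : Matrix (Fin 3) (Fin 3) (w.1.adicCompletion L)) =
        !![1, 0, 0;
           -(galAdicCompletionMap (L := L) (IsCMField.complexConj L) hw x * (galAdicCompletionMap (L := L) (IsCMField.complexConj L) hw z)⁻¹), 1, 0;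
           z⁻¹, x * z⁻¹, 1]) :
    (κ : ↥(unitaryGroupOfForm (conjLocal L (IsCMField.complexConj L) v) (cmLocalForm L 3 v))) ∈ ((cmBorelTriple L 3 v).N).map (MulAut.conj w₀).toMonoidHom := by
  have h := BposCellCoverTwoDepthCM.symm_mem_map_conj_of_mem_map_conj L v w hw eA heA w₀ hw₀ (lower_mem_map_conj_model L v w hw eA hκ)
  rwa [ContinuousMulEquiv.symm_apply_apply] at h

include hw heA hw₀ in
/-- **`w₀ · u · w₀ ∈ N̄(L⁺_v)`** for `u ∈ N(L⁺_v)` (`w₀⁻¹ = w₀`, ★ `weylLongU_mul_weylLongU` through `eA`). [cite: Rogawski1990, §1.10 p. 9] -/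
theorem conj_mem_map_conj {u : Gqs L v} (hu : (u : ↥(unitaryGroupOfForm (conjLocal L (IsCMField.complexConj L) v) (cmLocalForm L 3 v))) ∈ (cmBorelTriple L 3 v).N) :
    ((w₀ * u * w₀ : Gqs L v) : ↥(unitaryGroupOfForm (conjLocal L (IsCMField.complexConj L) v) (cmLocalForm L 3 v))) ∈ ((cmBorelTriple L 3 v).N).map (MulAut.conj w₀).toMonoidHom := by
  have hww : w₀ * w₀ = 1 := eA.injective (by
    rw [map_mul, map_one, map_weyl_eq_weylLongU L v w hw eA heA w₀ hw₀, weylLongU_mul_weylLongU])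
  exact Subgroup.mem_map.2 ⟨u, hu, by rw [MulEquiv.coe_toMonoidHom, MulAut.conj_apply, inv_eq_of_mul_eq_one_right hww]⟩

/-! ## §2 On `J_e`: the two constant cell values -/

section Eigen

variable (χ₁ : (LocalRing L v)ˣ →* ℂˣ)

open Classical in
/-- `θ(n) = 1` for `n ∈ N(L⁺_v)` (`n₀₀ = 1` for an upper unitriangular `n`; cf. ★ `K2E3IwahoriCellMembership.theta_eq_one_of_mem_N`). [cite: Rogawski1990, §1.10 p. 9] -/
theorem theta_eq_one_of_mem_N {n : Gqs L v} (hn : (n : ↥(unitaryGroupOfForm (conjLocal L (IsCMField.complexConj L) v) (cmLocalForm L 3 v))) ∈ (cmBorelTriple L 3 v).N) :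
    (if h : IsUnit (((n.val : GL (Fin 3) (LocalRing L v)) : Matrix (Fin 3) (Fin 3) (LocalRing L v)) 0 0) then ((χ₁ h.unit : ℂˣ) : ℂ) else 0) = 1 := by
  have h00 : ((n.val : GL (Fin 3) (LocalRing L v)) : Matrix (Fin 3) (Fin 3) (LocalRing L v)) 0 0 = 1 :=
    ((mem_unipotentU_iff (σ := conjLocal L (IsCMField.complexConj L) v) (J := cmLocalForm L 3 v) n).1
      (show n ∈ unipotentU (conjLocal L (IsCMField.complexConj L) v) (cmLocalForm L 3 v) from hn)).2 0
  have h1 : IsUnit (((n.val : GL (Fin 3) (LocalRing L v)) : Matrix (Fin 3) (Fin 3) (LocalRing L v)) 0 0) := by rw [h00]; exact isUnit_one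
  have hunit : h1.unit = 1 := Units.ext (by rw [IsUnit.unit_spec, h00, Units.val_one])
  rw [dif_pos h1, hunit, map_one, Units.val_one]

open Classical in
set_option maxHeartbeats 1600000 in
set_option synthInstance.maxHeartbeats 400000 in
-- two definitionally equal carriers of `U(Φ₃)(L⁺_v)` (`Gqs L v` and the matrix subgroup): slow unification (class of ★ `K2E3BranchBCasselmanPairIntegrands`)
/-- **`f(w₀ u) = f(w₀)` for `u ∈ N(L⁺_v) ∩ J_e`** (`f(w₀u) = θ(u) f(w₀)` ★ `toFun_weyl_mul_of_mem` at `J_e`; `θ(u) = 1`, `u₀₀ = 1`).  The integrand of `Λ_1 f_w = vol(N ∩ J_e)` (memo (M12)).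
[cite: Casselman1995, §6.3] [cite: Roche1998, §3–§4] -/
theorem toFun_weyl_mul_eq_of_mem
    (f : haveI := locallyCompactSpace_cmBorelU L 3 v
      Representation.SmoothInd (cmBorelTriple L 3 v).P
        (Representation.twist (((Representation.trivial ℂ ↥(torusU (conjLocal L (IsCMField.complexConj L) v) (cmLocalForm L 3 v)) ℂ).twist
          (cmTorusCharPair L v χ₁ 1)).comp (cmBorelTriple L 3 v).proj) (rootDeltaChar (cmBorelTriple L 3 v).P)))
    (heig : ∀ x ∈ Je, (haveI := locallyCompactSpace_cmBorelU L 3 v; Representation.smoothIndRep _ _ x f) =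
      (if h : IsUnit (((x.val : GL (Fin 3) (LocalRing L v)) : Matrix (Fin 3) (Fin 3) (LocalRing L v)) 0 0) then ((χ₁ h.unit : ℂˣ) : ℂ) else 0) • f)
    {u : Gqs L v} (hu : (u : ↥(unitaryGroupOfForm (conjLocal L (IsCMField.complexConj L) v) (cmLocalForm L 3 v))) ∈ (cmBorelTriple L 3 v).N) (huJ : u ∈ Je) :
    f.toFun (w₀ * u) = f.toFun w₀ := by
  haveI := locallyCompactSpace_cmBorelU L 3 v
  have h := toFun_weyl_mul_of_mem L v Je (cmBorelTriple L 3 v) w₀ _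
    (fun g : Gqs L v => if h : IsUnit (((g.val : GL (Fin 3) (LocalRing L v)) : Matrix (Fin 3) (Fin 3) (LocalRing L v)) 0 0) then ((χ₁ h.unit : ℂˣ) : ℂ) else 0) f heig huJ
  rw [theta_eq_one_of_mem_N L v χ₁ hu, one_mul] at h
  exact h

open Classical in
include hw heA hw₀ in
set_option maxHeartbeats 1600000 in
set_option synthInstance.maxHeartbeats 400000 in
-- two carriers, slow unification (as above)
/-- **`f(w₀ u w₀) = f(1)` for `u ∈ N(L⁺_v)` with `w₀uw₀ ∈ J_e`** (`f(w₀uw₀) = θ(w₀uw₀) f(1)` ★ `toFun_conj_of_mem` at `J_e`; `θ = 1` on `N̄` ★ `theta_eq_one_of_mem_map`).  The integrand of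
`Λ_{w₀} f₁ = vol{n : w₀nw₀ ∈ J_e}` (memo (M21)). [cite: Casselman1995, §6.3] [cite: Roche1998, §3–§4] -/
theorem toFun_conj_weyl_eq_of_mem
    (f : haveI := locallyCompactSpace_cmBorelU L 3 v
      Representation.SmoothInd (cmBorelTriple L 3 v).P
        (Representation.twist (((Representation.trivial ℂ ↥(torusU (conjLocal L (IsCMField.complexConj L) v) (cmLocalForm L 3 v)) ℂ).twist
          (cmTorusCharPair L v χ₁ 1)).comp (cmBorelTriple L 3 v).proj) (rootDeltaChar (cmBorelTriple L 3 v).P)))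
    (heig : ∀ x ∈ Je, (haveI := locallyCompactSpace_cmBorelU L 3 v; Representation.smoothIndRep _ _ x f) =
      (if h : IsUnit (((x.val : GL (Fin 3) (LocalRing L v)) : Matrix (Fin 3) (Fin 3) (LocalRing L v)) 0 0) then ((χ₁ h.unit : ℂˣ) : ℂ) else 0) • f)
    {u : Gqs L v} (hu : (u : ↥(unitaryGroupOfForm (conjLocal L (IsCMField.complexConj L) v) (cmLocalForm L 3 v))) ∈ (cmBorelTriple L 3 v).N) (huJ : w₀ * u * w₀ ∈ Je) :
    f.toFun (w₀ * u * w₀) = f.toFun 1 := by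
  haveI := locallyCompactSpace_cmBorelU L 3 v
  have h := toFun_conj_of_mem L v Je (cmBorelTriple L 3 v) w₀ _
    (fun g : Gqs L v => if h : IsUnit (((g.val : GL (Fin 3) (LocalRing L v)) : Matrix (Fin 3) (Fin 3) (LocalRing L v)) 0 0) then ((χ₁ h.unit : ℂˣ) : ℂ) else 0) f heig huJ
  rw [theta_eq_one_of_mem_map L v w hw eA heA χ₁ (cmBorelTriple L 3 v) rfl w₀ hw₀ (conj_mem_map_conj L v w hw eA heA w₀ hw₀ hu), one_mul] at h
  exact h

open Classical in
include hw heA in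
/-- `θ(g) = 1` whenever the place matrix of `g` has `(0,0)`-entry `1` (one place over `v`: ★ `LocalRing.eq_iff_apply_eq`, ★ `coe_eA_apply`). [cite: Rogawski1990, §1.10 p. 9] -/
theorem theta_eq_one_of_coe_eA_apply_eq_one {g : Gqs L v}
    (h00 : (((eA g : ↥(unitaryGroupOfForm (galAdicCompletionMap (L := L) (IsCMField.complexConj L) hw) ((StdForm.antidiagonal 3).over (w.1.adicCompletion L)))) :
        GL (Fin 3) (w.1.adicCompletion L)) : Matrix (Fin 3) (Fin 3) (w.1.adicCompletion L)) 0 0 = 1) :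
    (if h : IsUnit (((g.val : GL (Fin 3) (LocalRing L v)) : Matrix (Fin 3) (Fin 3) (LocalRing L v)) 0 0) then ((χ₁ h.unit : ℂˣ) : ℂ) else 0) = 1 := by
  have h00' : ((g.val : GL (Fin 3) (LocalRing L v)) : Matrix (Fin 3) (Fin 3) (LocalRing L v)) 0 0 = 1 := by
    rw [LocalRing.eq_iff_apply_eq (IsCMField.complexConj L) (IsCMField.complexConj_ne_one L) w hw, ← coe_eA_apply L v w hw eA heA g 0 0, h00, Pi.one_apply]
  have h1 : IsUnit (((g.val : GL (Fin 3) (LocalRing L v)) : Matrix (Fin 3) (Fin 3) (LocalRing L v)) 0 0) := by rw [h00']; exact isUnit_one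
  have hunit : h1.unit = 1 := Units.ext (by rw [IsUnit.unit_spec, h00', Units.val_one])
  rw [dif_pos h1, hunit, map_one, Units.val_one]

/-! ## §3 The two big-cell values: the DEEP cell for `f(w₀u)`, the SHARP cell for `f(w₀uw₀)` -/

open Classical in
include hw heA hϖ hJg hJe hw₀ in
set_option maxHeartbeats 1600000 in
set_option synthInstance.maxHeartbeats 400000 in
-- two carriers, slow unification (as above)
/-- **THE DEEP CELL: `f(w₀ u) = χ₁((σb)⁻¹)·‖b‖⁻¹·f(1)`**, `b = u₀₂` (`b_w = z`), for `u ∈ N(L⁺_v)` with `|z|_w ≥ |ϖ|⁻¹` and `|x∕z|_w ≤ |ϖ|^{r₂}`: `w₀u = p·κ` (§1), `κ = ū(x∕z, 1∕z) ∈ J_e` (§1 test: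
`|σx∕σz| = |x∕z| ≤ |ϖ|^{r₂}`, `|1∕z| ≤ |ϖ|`), `f(pκ) = τ(p)θ(κ)f(1)` (★ `toFun_weyl_mul_of_eq_mul` at `J_e`), `θ(κ) = 1` (`κ₀₀ = 1`), `τ(p)` by ★ `tau_apply_one_eq` (at `χ₂ = 1`).  The integrand of
`G₁ = Λ_1 f₁` on its support `{|b| ≥ |ϖ|⁻¹, |y| ≤ |ϖ|^{r₂}|b|}` (memo (M11)). [cite: Casselman1980, §3] [cite: Casselman1995, Prop. 1.3.1, §6.4] [cite: Roche1998, §3–§4] [cite: Keys1984, §7 Theorem (2) p. 126] -/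
theorem toFun_weyl_mul_eq_of_deep
    (f : haveI := locallyCompactSpace_cmBorelU L 3 v
      Representation.SmoothInd (cmBorelTriple L 3 v).P
        (Representation.twist (((Representation.trivial ℂ ↥(torusU (conjLocal L (IsCMField.complexConj L) v) (cmLocalForm L 3 v)) ℂ).twist
          (cmTorusCharPair L v χ₁ 1)).comp (cmBorelTriple L 3 v).proj) (rootDeltaChar (cmBorelTriple L 3 v).P)))
    (heig : ∀ x ∈ Je, (haveI := locallyCompactSpace_cmBorelU L 3 v; Representation.smoothIndRep _ _ x f) =
      (if h : IsUnit (((x.val : GL (Fin 3) (LocalRing L v)) : Matrix (Fin 3) (Fin 3) (LocalRing L v)) 0 0) then ((χ₁ h.unit : ℂˣ) : ℂ) else 0) • f)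
    {u : Gqs L v} (hu : (u : ↥(unitaryGroupOfForm (conjLocal L (IsCMField.complexConj L) v) (cmLocalForm L 3 v))) ∈ (cmBorelTriple L 3 v).N)
    (hb : IsUnit (((u.val : GL (Fin 3) (LocalRing L v)) : Matrix (Fin 3) (Fin 3) (LocalRing L v)) 0 2))
    (hdeep : (Valued.v ϖ ^ 1)⁻¹ ≤ Valued.v ((((u.val : GL (Fin 3) (LocalRing L v)) : Matrix (Fin 3) (Fin 3) (LocalRing L v)) 0 2) w) ∧
      Valued.v ((((u.val : GL (Fin 3) (LocalRing L v)) : Matrix (Fin 3) (Fin 3) (LocalRing L v)) 0 1) w /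
        (((u.val : GL (Fin 3) (LocalRing L v)) : Matrix (Fin 3) (Fin 3) (LocalRing L v)) 0 2) w) ≤ Valued.v ϖ ^ r₂) :
    f.toFun (w₀ * u) =
      ((((χ₁ (Units.map (conjLocal L (IsCMField.complexConj L) v : LocalRing L v →* LocalRing L v) hb.unit))⁻¹ : ℂˣ) : ℂ) *
        ((((unitModulusChar (LocalRing L v) hb.unit)⁻¹ : ℝ≥0) : ℝ) : ℂ)) * f.toFun 1 := by
  haveI := locallyCompactSpace_cmBorelU L 3 v
  have hvσ : ∀ y, Valued.v (galAdicCompletionMap (L := L) (IsCMField.complexConj L) hw y) = Valued.v y :=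
    fun y => valued_galAdicCompletionMap (L := L) (IsCMField.complexConj L) hw y
  obtain ⟨x, z, hux, hrel⟩ := exists_coe_eA_eq_upper L v w hw eA heA (cmBorelTriple L 3 v) rfl hu
  have hz02 : (((u.val : GL (Fin 3) (LocalRing L v)) : Matrix (Fin 3) (Fin 3) (LocalRing L v)) 0 2) w = z := by
    rw [← coe_eA_apply L v w hw eA heA u 0 2, hux]; rfl
  have hx01 : (((u.val : GL (Fin 3) (LocalRing L v)) : Matrix (Fin 3) (Fin 3) (LocalRing L v)) 0 1) w = x := by
    rw [← coe_eA_apply L v w hw eA heA u 0 1, hux]; rfl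
  rw [hz02, hx01] at hdeep
  obtain ⟨hzϖ, hxz⟩ := hdeep
  have hvϖ0 : Valued.v ϖ ≠ 0 := (Valuation.ne_zero_iff _).2 (CartanUnique.uniformizer_ne_zero hϖ)
  have hz0 : z ≠ 0 := fun h => by
    rw [h, map_zero] at hzϖ
    exact absurd hzϖ (not_le.2 (inv_pos.2 (pow_pos (zero_lt_iff.2 hvϖ0) _)))
  -- `w₀u = p·κ`, `κ ∈ J_e`
  obtain ⟨p, hp, κ, hfac, hpm, hκm⟩ := exists_eq_mul_of_ne_zero L v w hw eA heA w₀ hw₀ hux hrel hz0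
  have hκJ : κ ∈ Je := by
    refine mem_levelGroup_of_coe_eq_lower L v w hw eA r₁ r₂ Jg hJg Je hJe hκm ?_ ?_ (K2E3LowerUnipotentDeepCellTwoDepth.v_inv_le_pow_of_le_v hϖ hzϖ)
    · rw [Valuation.map_neg, map_mul, map_inv₀, hvσ, hvσ, ← map_inv₀, ← map_mul, ← div_eq_mul_inv]; exact hxz
    · rw [← div_eq_mul_inv]; exact hxz
  -- the cell value, `θ(κ) = 1`, the `τ(p)`-reading
  have hcell := toFun_weyl_mul_of_eq_mul L v Je (cmBorelTriple L 3 v) w₀ _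
    (fun g : Gqs L v => if h : IsUnit (((g.val : GL (Fin 3) (LocalRing L v)) : Matrix (Fin 3) (Fin 3) (LocalRing L v)) 0 0) then ((χ₁ h.unit : ℂˣ) : ℂ) else 0) f heig hp hκJ hfac
  have hθκ := theta_eq_one_of_coe_eA_apply_eq_one L v w hw eA heA χ₁ (g := κ) (by rw [hκm]; rfl)
  have hτ := K2E3BranchBCasselmanPairIntegrands.tau_apply_one_eq L v w hw eA heA χ₁ 1 hp hpm hb.unit (by rw [hb.unit_spec]; exact hz02)
  rw [MonoidHom.one_apply, Units.val_one, mul_one] at hτ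
  rw [hθκ, mul_one] at hcell
  exact hcell.trans (congrArg (· * f.toFun 1) hτ)

open Classical in
include hw heA hJg hJe hw₀ in
set_option maxHeartbeats 1600000 in
set_option synthInstance.maxHeartbeats 400000 in
-- two carriers, slow unification (as above)
/-- **THE SHARP CELL: `f(w₀ u w₀) = χ₁((σb)⁻¹)·‖b‖⁻¹·f(w₀)`**, `b = u₀₂`, for `u ∈ N(L⁺_v)` with `|x∕z|_w ≤ |ϖ|^{r₁}` and `|z|_w ≥ 1`: `w₀uw₀ = p·w₀·n₂` (§1), `n₂ = u(x∕z, 1∕z) ∈ J_e` (★ p862537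
`mem_of_coe_eq_upper`: `|x∕z| ≤ |ϖ|^{r₁}`, `|1∕z| ≤ 1 = |ϖ|⁰`), `f(p w₀ n₂) = τ(p)θ(n₂)f(w₀)` (★ `toFun_conj_of_eq_mul` at `J_e`), `θ(n₂) = 1`, `τ(p)` by ★ `tau_apply_one_eq`.  The integrand of
`G₂ = Λ_{w₀} f_w` on its support, the SHARP big cell `{|z| ≥ 1, |x| ≤ |ϖ|^{r₁}|z|}` (memo (M22)). [cite: Casselman1980, §3] [cite: Casselman1995, Prop. 1.3.1, §6.4] [cite: Roche1998, §3–§4]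
[cite: Keys1984, §7 Theorem (2) p. 126] -/
theorem toFun_conj_weyl_eq_of_sharp
    (f : haveI := locallyCompactSpace_cmBorelU L 3 v
      Representation.SmoothInd (cmBorelTriple L 3 v).P
        (Representation.twist (((Representation.trivial ℂ ↥(torusU (conjLocal L (IsCMField.complexConj L) v) (cmLocalForm L 3 v)) ℂ).twist
          (cmTorusCharPair L v χ₁ 1)).comp (cmBorelTriple L 3 v).proj) (rootDeltaChar (cmBorelTriple L 3 v).P)))
    (heig : ∀ x ∈ Je, (haveI := locallyCompactSpace_cmBorelU L 3 v; Representation.smoothIndRep _ _ x f) =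
      (if h : IsUnit (((x.val : GL (Fin 3) (LocalRing L v)) : Matrix (Fin 3) (Fin 3) (LocalRing L v)) 0 0) then ((χ₁ h.unit : ℂˣ) : ℂ) else 0) • f)
    {u : Gqs L v} (hu : (u : ↥(unitaryGroupOfForm (conjLocal L (IsCMField.complexConj L) v) (cmLocalForm L 3 v))) ∈ (cmBorelTriple L 3 v).N)
    (hb : IsUnit (((u.val : GL (Fin 3) (LocalRing L v)) : Matrix (Fin 3) (Fin 3) (LocalRing L v)) 0 2))
    (hsharp : Valued.v ((((u.val : GL (Fin 3) (LocalRing L v)) : Matrix (Fin 3) (Fin 3) (LocalRing L v)) 0 1) w /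
        (((u.val : GL (Fin 3) (LocalRing L v)) : Matrix (Fin 3) (Fin 3) (LocalRing L v)) 0 2) w) ≤ Valued.v ϖ ^ r₁ ∧
      (Valued.v ϖ ^ 0)⁻¹ ≤ Valued.v ((((u.val : GL (Fin 3) (LocalRing L v)) : Matrix (Fin 3) (Fin 3) (LocalRing L v)) 0 2) w)) :
    f.toFun (w₀ * u * w₀) =
      ((((χ₁ (Units.map (conjLocal L (IsCMField.complexConj L) v : LocalRing L v →* LocalRing L v) hb.unit))⁻¹ : ℂˣ) : ℂ) *
        ((((unitModulusChar (LocalRing L v) hb.unit)⁻¹ : ℝ≥0) : ℝ) : ℂ)) * f.toFun w₀ := by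
  haveI := locallyCompactSpace_cmBorelU L 3 v
  have hvσ : ∀ y, Valued.v (galAdicCompletionMap (L := L) (IsCMField.complexConj L) hw y) = Valued.v y :=
    fun y => valued_galAdicCompletionMap (L := L) (IsCMField.complexConj L) hw y
  obtain ⟨x, z, hux, hrel⟩ := exists_coe_eA_eq_upper L v w hw eA heA (cmBorelTriple L 3 v) rfl hu
  have hz02 : (((u.val : GL (Fin 3) (LocalRing L v)) : Matrix (Fin 3) (Fin 3) (LocalRing L v)) 0 2) w = z := by
    rw [← coe_eA_apply L v w hw eA heA u 0 2, hux]; rfl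
  have hx01 : (((u.val : GL (Fin 3) (LocalRing L v)) : Matrix (Fin 3) (Fin 3) (LocalRing L v)) 0 1) w = x := by
    rw [← coe_eA_apply L v w hw eA heA u 0 1, hux]; rfl
  rw [hz02, hx01, pow_zero, inv_one] at hsharp
  obtain ⟨hxz, hz1⟩ := hsharp
  have hz0 : z ≠ 0 := fun h => by rw [h, map_zero] at hz1; exact not_le_of_gt zero_lt_one hz1
  -- `w₀uw₀ = p·w₀·n₂`, `n₂ ∈ J_e`
  obtain ⟨p, hp, n₂, hfac, hpm, hn₂m⟩ := exists_conj_eq_mul_of_ne_zero L v w hw eA heA w₀ hw₀ hux hrel hz0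
  have hn₂' : (((eA n₂ : ↥(unitaryGroupOfForm (galAdicCompletionMap (L := L) (IsCMField.complexConj L) hw) ((StdForm.antidiagonal 3).over (w.1.adicCompletion L)))) :
        GL (Fin 3) (w.1.adicCompletion L)) : Matrix (Fin 3) (Fin 3) (w.1.adicCompletion L)) =
      !![1, x * z⁻¹, z⁻¹; 0, 1, -galAdicCompletionMap (L := L) (IsCMField.complexConj L) hw (x * z⁻¹); 0, 0, 1] := by
    rw [hn₂m, map_mul, map_inv₀]
  have hn₂J : n₂ ∈ Je := by
    rw [hJe, Subgroup.mem_comap]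
    refine K2E3LowerUnipotentDeepCellTwoDepth.mem_of_coe_eq_upper (galAdicCompletionMap (L := L) (IsCMField.complexConj L) hw) hvσ _ Jg hJg
      (fun i => by fin_cases i <;> rfl) (fun i j => by fin_cases i <;> fin_cases j <;> rfl) hn₂' ?_ ?_
    · rw [← div_eq_mul_inv]; exact hxz
    · rw [map_inv₀]
      exact (inv_le_one_of_one_le₀ hz1).trans (by simp)
  -- the cell value, `θ(n₂) = 1`, the `τ(p)`-reading
  have hcell := toFun_conj_of_eq_mul L v Je (cmBorelTriple L 3 v) w₀ _
    (fun g : Gqs L v => if h : IsUnit (((g.val : GL (Fin 3) (LocalRing L v)) : Matrix (Fin 3) (Fin 3) (LocalRing L v)) 0 0) then ((χ₁ h.unit : ℂˣ) : ℂ) else 0) f heig hp hn₂J hfac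
  have hθn := theta_eq_one_of_coe_eA_apply_eq_one L v w hw eA heA χ₁ (g := n₂) (by rw [hn₂m]; rfl)
  have hτ := K2E3BranchBCasselmanPairIntegrands.tau_apply_one_eq L v w hw eA heA χ₁ 1 hp hpm hb.unit (by rw [hb.unit_spec]; exact hz02)
  rw [MonoidHom.one_apply, Units.val_one, mul_one] at hτ
  rw [hθn, mul_one] at hcell
  exact hcell.trans (congrArg (· * f.toFun w₀) hτ)

end Eigen

end Summit.HodgeConjecture.HodgeConjecture.R90.S1.BposPairIntegrandsTwoDepth

end
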